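import Mathlib
import HarnessLib
import HarnessLib.Audit
import Summits.AtomisticToContinuum.Statement
import Literature.MathematicalPhysics.StatisticalMechanics.BarlowStackingEnergy

/-!
Route: OneSignChangeClass

CLOSED (retired) 2026-08-15T13:45:07Z by operator:999:1257524 — reason: not-a-thesis: assembly does not conclude the sub-problem Statement — note: D-0027 §2.1 audit (human 2026-08-15: routes that do not decide the summit are removed): the assembly concludes `Literature.MathematicalPhysics.StatisticalMechanics.Crystallization`, not the sub-problem statement; a NEW conforming route may be opened from the same idea (generated `closes : … → _root_. The file is kept as the record of this route; refuted decls are indexed as negative knowledge (`ledger negatives`).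

# Route OneSignChangeClass — one sign change of the Bernstein measure — class-1 potentials
crystallize in ℝ³, and Lennard-Jones is class 1

RISING-SEA thesis realising card one-sign-change-class (L3a). Call a pair potential V CLASS 1 when
it is a Gaussian
(Bernstein–Widder) mixture V(r) = ∫_0^∞ e^{-t r²} w(t) dt whose density changes sign exactly ONCE —
w ≤ 0 on (0,t₀)
(attraction = long range), w ≥ 0 on [t₀,∞) (repulsion = short range) — and has a divergent core, a
negative value, a
summable tail |V(r)| ≤ C r^{-3-ε} (r ≥ 1) and is stable. It suffices to show X =
ClassOneCrystallizes: EVERY class-1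
potential satisfies HasPeriodicGroundStateEnergy V 3 ∧ IsCrystallizing V 3; Lennard-Jones is class 1
with the explicit
density w(t) = t⁵/1440 − t²/12, t₀ = 120^{1/3} (support LennardJonesClassOne, provable now), so X
gives Crystallization.
X = X_E ∧ X_P: X_E = ClassOneEnergy (energetic form for the class), X_P = ClassOnePositional
(Blanc–Lewin form given the
energetic one). The class is the natural sea level: one sign change is the one structural fact about
r⁻¹²/12 − r⁻⁶/6 that
survives every averaging the problem performs (radial derivative, layer sums, theta functions,
Fourier transform), because
e^{-ts} is a sign-regular kernel and ONE crossing is transported by a three-line monotonicity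
argument (e^{t₀ s}·∫e^{-ts}dm(t)
is non-increasing in s when m ≤ 0 below t₀ and ≥ 0 above): class-1 potentials have exactly one well
(ClassOneSingleWell),
their Barlow registry couplings J_k change sign at most once, + … + then − − …
(ClassOneRegistryOneCrossing), and theta-ordered
pairs of structures (fcc/hcp, BeterminPetrache2017) exchange stability exactly once along the class
— no second length
scale in real space, no second ring in Fourier space, no re-entrance: none of the known mechanisms
for one-component
aperiodic order is available inside class 1.
Lean: `∀ V : ℝ → ℝ, ((∃ (w : ℝ → ℝ) (t₀ : ℝ), 0 < t₀ ∧ (∀ t ∈ Set.Ioo 0 t₀, w t ≤ 0) ∧ (∀ t, t₀ ≤ t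
→ 0 ≤ w t) ∧ ∀ r : ℝ, 0 < r → MeasureTheory.IntegrableOn (fun t => Real.exp (-(t * r ^ 2)) * w t)
(Set.Ioi 0) ∧ V r = ∫ t in Set.Ioi 0, Real.exp (-(t * r ^ 2)) * w t) ∧ Filter.Tendsto V (nhdsWithin
0 (Set.Ioi 0)) Filter.atTop ∧ (∃ r : ℝ, 0 < r ∧ V r < 0) ∧ (∃ C ε : ℝ, 0 < ε ∧ ∀ r : ℝ, 1 ≤ r → |V
r| ≤ C * r ^ (-(3 + ε))) ∧ (∃ B : ℝ, ∀ (N : ℕ) (x : Fin N → EuclideanSpace ℝ (Fin 3)),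
Function.Injective x → -(B * (N : ℝ)) ≤
Literature.MathematicalPhysics.StatisticalMechanics.interactionEnergy V x)) →
Literature.MathematicalPhysics.StatisticalMechanics.HasPeriodicGroundStateEnergy V 3 ∧
Literature.MathematicalPhysics.StatisticalMechanics.IsCrystallizing V 3`

## Assembly
Pure logic, checked sorry-free in the planner's Sketch.lean (assembly_proof, axioms propext /
Classical.choice / Quot.sound):
instantiate ClassOneEnergy and ClassOnePositional at V = lennardJones with the witness
LennardJonesClassOne (its statement is
literally the class-1 hypothesis at lennardJones); the conjunction of the two conclusions is
Literature.MathematicalPhysics.StatisticalMechanics.Crystallization by definition.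
ClassOneStackingPeriodic and the two
lemma supports are not in the implication chain: they are the foreseen children / structural inputs
of ClassOneEnergy
(Two-layer plan) filed now because they are the attackable statements of the line.

Rationale: WHY THIS LINE. Mechanism: total positivity of the Laplace kernel (Karlin1968, PolyaSzego1925 Part V)
applied to the signed Bernstein
measure of the potential — the invariant "number of sign changes of w" — imported from the theory of
sign-regular kernels
into the crystallization problem; the lattice-energy literature already organises LATTICE theorems
by the sign structure of
the inverse-Laplace measure (Bétermin 2016 arXiv:1502.03839 §4; BeterminPetrache2019;
BeterminSamajTravenec2022 §3.1 observe
numerically a single fcc/hcp transition along Lennard-Jones-type families), but nobody has used the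
sign-change COUNT as the
hypothesis of a crystallization statement over all configurations, nor pushed one crossing through
the layer sums of a
Barlow stacking (BeterminPetrache2017 / Regev–Stephens-Davidowitz arXiv:1502.04796 give the
positivity of the layer kernel
that makes this work). What the line does that the other Crystallization routes do not: every open
route
(CrystalLocalRigidity, CrystalKissingRigidity, PoissonBesselStacking, CrystalThreeCone, …) is
Lennard-Jones-specific and
numerical at the decisive step; this one states the conjunct at the generality where it is
FALSIFIABLE by other potentials
(the card's census: every reported one-component quasicrystal/Frank–Kasper former should have ≥ 2
sign changes) and supplies
class-wide structural lemmas (single well, one-crossing registry couplings, one fcc/hcp switch) that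
the certificate routes
can cite against "exotic competitor" objections. The negatives index is empty; no refuted statement
is restated.

RANKED CRUXES. #0 ClassOneCrystallizes (target) — X: every class-1 pair potential (one-sign-change
Gaussian mixture with divergent core, a negative value, summable tail r^{-3-ε} and stability) has a
periodic minimiser of the energy per particle to which E(N)/N converges, and its ground states
converge locally, up to translations and subsequences, to a non-zero periodic point measure (card
L3a; Lennard-Jones, Mie (n,m) with n > m > 3 are members; Morse and Buckingham are not: no divergent
core, resp. two sign changes). (why it might fail: it asserts 3-D crystallization for a whole class
containing arbitrarily soft members (cores ~ r^{-3.1}, tails ~ −r^{-3.05}); one class-1 potential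
with a quasicrystalline or infinitely degenerate aperiodic ground state — none is known, none is
excluded — refutes it.) [arXiv:1502.03839, BeterminPetrache2019, BlancLewin2015,
doi:10.1103/PhysRevLett.79.1261]
#2 ClassOnePositional (crux) — X_P: for every class-1 potential V, the energetic form
HasPeriodicGroundStateEnergy V 3 implies the Blanc–Lewin positional form IsCrystallizing V 3 (card
L3a, positional half; the step where "one length scale ⇒ no aperiodic order" must become a rigidity
theorem). [deps: ClassOneEnergy] [difficulty: open-problem] (why it might fail: 3-D positional
rigidity for PAIR potentials is unknown even for Lennard-Jones (Flatley–Theil need a three-body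
term); inside the class, at the fcc/hcp balance point or for soft tails, degenerate stackings are
exact minimisers and ground states need not settle on one periodic pattern.) [BlancLewin2015,
FlatleyTheil2015, Theil2006, BeterminPetrache2019]
#3 ClassOneEnergy (crux) — X_E: for every class-1 potential V, the minimum of the energy per
particle over periodic configurations of ℝ³ is attained and E(N)/N converges to it (card L3a,
energetic half; for Lennard-Jones this is the conjunct's first half with hcp-type expected, for soft
members bcc or fcc — the class does not promise close packing). [difficulty: open-problem] (why it
might fail: attainment can fail inside class 1: for soft members the registry couplings are + for k
< k₀ (k₀ ≥ 4) then −, a frustrated ANNNI-type chain whose optimal period may diverge at multiphase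
points (FisherSzpilka1987, Hubbard1978); non-Barlow competitors for soft cores are untested.)
[BlancLewin2015, BeterminSamajTravenec2022, BeterminPetrache2019, FisherSzpilka1987, Hubbard1978]
#4 ClassOneStackingPeriodic (crux) — for every class-1 potential V and every ideal Barlow geometry
(in-layer spacing a > 0, layer spacing h with h² = 2a²/3), the one-dimensional stacking model with
couplings J_k = barlowCoupling V a h k (aligned minus non-aligned layer interaction) has a PERIODIC
Hägg sequence minimising the stacking energy density haggStackingEnergy among all Hägg sequences —
the class-wide form of stacking selection, where the one-crossing sign pattern of J
(ClassOneRegistryOneCrossing) is the only structural input; foreseen child of ClassOneEnergy. [deps: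
ClassOneRegistryOneCrossing] [difficulty: L] (why it might fail: frustration: if J₂, J₃ > 0 > J₄,…
no 3-letter stacking avoids every penalty (pigeonhole on 4 layers) and competing infinite-range
tails may push the optimal period to infinity at multiphase points (FisherSzpilka1987, Hubbard1978
barrier); "every a" includes unphysical densities.) [FisherSzpilka1987, RadinSchulman1983,
Hubbard1978, BeterminPetrache2017, PartayOrtnerCsanyi2017, arXiv:1502.04796]
#9 LennardJonesClassOne (support) — Lennard-Jones is class 1: lennardJones r = ∫_0^∞ e^{-t
r²}(t⁵/1440 − t²/12) dt for r > 0 (Γ(6) = 120, Γ(3) = 2; Mathlib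
Real.integral_rpow_mul_exp_neg_mul_Ioi), one sign change at t₀ = 120^{1/3}; divergent core, V(1) =
−1/12 < 0, |V(r)| ≤ r⁻⁶/4 for r ≥ 1 (ε = 3), stability from the proved fact
lennardJones_stable_holds (StablePotentialsProofs). [difficulty: provable-now] [BlancLewin2015,
Schoenberg1938, PolyaSzego1925]
#9 ClassOneRegistryOneCrossing (support) — one crossing survives the layer sums (card L1/L2 engine):
for a one-sign-change Gaussian mixture V with summable tail and any triangular-layer geometry a, h >
0, the registry couplings k ↦ J_k = barlowCoupling V a h k (k ≥ 1) change sign at most once and only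
from + to −: J_{k₁} ≤ 0 ⇒ J_{k₂} ≤ 0 for k₂ ≥ k₁. Proof sketch: J_k = D(kh), D(z) = ∫ e^{-t z²} F(t)
w(t) dt with F(t) = Θ_Λ(t) − Θ_{Λ+w}(t) ≥ 0 (shifted-Gaussian-mass inequality,
Regev–Stephens-Davidowitz arXiv:1502.04796 Thm 1.1 / BeterminPetrache2017), and s ↦ e^{t₀ s} D(√s)
is non-increasing. [difficulty: M] [arXiv:1502.04796, BeterminPetrache2017, Karlin1968,
PolyaSzego1925]
#9 ClassOneSingleWell (support) — one crossing in real space (card L1, real half): a one-sign-change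
Gaussian mixture with divergent core and a negative value has exactly one well — there is r₀ > 0
with V strictly decreasing on (0, r₀] and strictly increasing on [r₀, ∞) (no shoulder, no bump, no
second minimum: the Dzugutov / Lennard-Jones–Gauss mechanisms for one-component quasicrystals are
unavailable in class 1). Proof sketch: V′(r) = −2r g(r²), g(s) = ∫ t e^{-ts} w(t) dt, and e^{t₀ s}
g(s) is strictly decreasing. [difficulty: M] [Karlin1968, PolyaSzego1925, Schoenberg1938]

TWO-LAYER PLAN. Foreseen glued splits (k ≤ 3, depth 1), nothing filed now: ClassOneEnergy ⇐
ClassOneBarlowReduction (class-wide analogue of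
PeriodicReductionToBarlow 3062 / RefuteCrystalPeriodicMin crux 4: the periodic infimum equals the
infimum over relaxed
Barlow stackings, first in the Lennard-Jones-like corner k₀ ≤ 2, i.e. J₂ < 0) →
ClassOneStackingPeriodic →
thermodynamic-limit bookkeeping → ClassOneEnergy. ClassOnePositional ⇐ class-wide BulkDefectVanish
(0751-type) →
DefectVanishCrystallizes-type glue → ClassOnePositional. ClassOneStackingPeriodic ⇐ (k₀ ≤ 2 and −J
antitone beyond:
monotone-pairing exchange ⇒ ABAB) → (k₀ = 3 ⇒ ABC) → (frustrated k₀ ≥ 4: finite-range gap + tail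
perturbation).

KILL CRITERIA. A class-1 potential (sc(w) = 1 verified by explicit Bernstein inversion) with a
certified — or numerically robust and then
certified for one instance — non-periodic ground state or non-attained periodic infimum refutes
ClassOneEnergy and the
target: close `refuted:ClassOneEnergy` (the supports survive as lemmas for PoissonBesselStacking /
monotone-pairing).
ClassOneStackingPeriodic refuted at a PHYSICAL geometry (a near the zero-pressure spacing) ⇒ pivot:
restate the class with
the extra hypothesis "J₂ < 0" (k₀ ≤ 2, the Lennard-Jones corner, decidable per potential) and
re-rank; refuted only at an
unphysical density ⇒ restate with a density window. ClassOnePositional refuted while ClassOneEnergy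
stands ⇒ the class is
the right sea level for the energetic conjunct only; keep ranks 3–4, drop the assembly to a support
of other routes'
positional cruxes. Crystallization proved by a Lennard-Jones-specific route moots the assembly, not
the class statements.

NOT DECOMPOSED YET. (i) The Mie one-switch theorem (card L2b/L3b): at zero pressure hcp beats fcc
for V = r⁻ⁿ/n − r⁻ᵐ/m iff g(m) > g(n) with
g(s) = log(A_hcp(s)/A_fcc(s))/s (A = lattice sum Σ r⁻ˢ at unit spacing; A_hcp > A_fcc for all s by
θ_fcc < θ_hcp,
BeterminPetrache2017, and Mellin); "exactly one switch n_c(m)" ⇔ unimodality of g on (3, ∞) — a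
certified lattice-sum
statement (interval arithmetic + asymptotics g → 0 at both ends; note: unimodality of g, not
monotonicity of
log(A_hcp/A_fcc) as the card writes), matching the single boundary curve of
BeterminSamajTravenec2022 Fig. 5; it decides
WHICH minimiser, which the conjunct does not ask, so it waits as a child of ClassOneEnergy for the
Mie sub-family.
(ii) The Fourier half of L1 (core-regularised V̂ has ≤ 1 interior extremum in |k|; a shape statement
— for the
T-regularised Lennard-Jones V̂_T is even positive — recorded, not filed). (iii) The affine switch
L2a (e_c(hcp) − e_c(fcc)
affine in the attraction strength c; bookkeeping). (iv) The bcc corner of the class (repulsion r⁻ⁿ,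
3 < n < n_c, weak
long-range attraction: periodic, not Barlow) and the non-Barlow competitor catalogue. (v)
Thermodynamic-limit bookkeeping
for the class (periodisation, trial states, minimal distance) — children of ClassOneEnergy /
ClassOnePositional later.
(vi) A named predicate IsOneCrossingMixture replacing the inline class-1 hypothesis (definition
request below).

CHEAPEST FALSIFIER. The card's census L4, run as a lookup: is there ANY one-component radial
potential with a one-sign-change Bernstein density
and a reported non-periodic (quasicrystalline) T = 0 ground state? The known one-component
quasicrystal formers checked on
paper are all outside class 1 (Dzugutov 1993: bump ⇒ sc = ∞; Lennard-Jones–Gauss: second well ⇒ sc ≥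
2;
Engel–Damasceno–Phillips–Glotzer 2015: oscillating ⇒ sc = ∞; Lifshitz–Petrich two-ring designs: two
Fourier minima,
impossible in class 1), and Narasimhan–Jarić's square well is a non-smooth limit, not a member. The
cheapest COMPUTATION
(not run in this planner seat): for Mie (n, m) on a grid of (3, 20]² and h/a ∈ [0.78, 0.85], compute
J_k = barlowCoupling
to k ≤ 12 with tail bounds and solve the truncated stacking model by minimum mean cycle for K = 4,
…, 12; an optimal period
that keeps growing with K flags ClassOneStackingPeriodic (and attainment in ClassOneEnergy) as
suspect-false.

NUMBERS. Lennard-Jones: w(t) = t⁵/1440 − t²/12, t₀ = 120^{1/3} ≈ 4.93, crossing length t₀^{-1/2} ≈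
0.45 equilibrium distances;
e(hcp) below e(fcc) by ≈ 10⁻⁴ relative (KiharaKoba1952; BlancLewin2015 §2.3); Lennard-Jones registry
couplings J_k < 0
for all k ≥ 2 with |J_k| ≍ e^{−5.9 k} (route PoissonBesselStacking), i.e. k₀ ≤ 2 for Lennard-Jones;
BeterminSamajTravenec2022
§3.1, Fig. 5 (p. 9): a single fcc/hcp boundary in the (m, n) plane of Mie exponents, (12, 6) on the
hcp side, "large
well ⇒ FCC, narrow well ⇒ HCP"; θ_fcc(α) < θ_hcp(α) for all α (BeterminPetrache2017 Thm 1.1). Items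
at open: 8 (1 target,
3 cruxes, 3 support, 1 assembly).

DEFINITION REQUESTS. (1) notion IsOneCrossingMixture (V : ℝ → ℝ) : Prop — the inline class-1
hypothesis of the items (∃ density w, threshold t₀
with w ≤ 0 on (0,t₀), ≥ 0 on [t₀,∞), V r = ∫_{Ioi 0} e^{-t r²} w t for r > 0, integrable), topic
Literature/MathematicalPhysics/StatisticalMechanics next to lennardJones; once landed the items are
restated over it
(route edit --restate, same meaning). (2) cite fact wanted: Regev–Stephens-Davidowitz 2017
(arXiv:1502.04796, SIAM J.
Discrete Math. 31) Thm 1.1: Σ_{x ∈ L} e^{-t|x − u|²} ≤ Σ_{x ∈ L} e^{-t|x|²} for every lattice L ⊂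
ℝⁿ, u ∈ ℝⁿ, t > 0
(equivalently BeterminPetrache2017's layer positivity) — the input of ClassOneRegistryOneCrossing.

Novelty: Searches (2026-08-15): `lit search --source zbmath "Bétermin theta function lattice energy"` (10:
the Bétermin corpus —
BeterminPetrache2019, Bétermin 2019 Morse arXiv:1901.08957, Luo–Wei 2025 doi:10.1063/5.0269606, …);
`--source zbmath
"Lennard-Jones hcp fcc lattice energy"` (2: BeterminSamajTravenec2022, arXiv:1901.08957); `--source
zbmath "variation
diminishing Laplace transform"` (5, all statistics, none on interaction potentials); `--source
zbmath "ANNNI ground state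
polytype"`, `"quasicrystal pair potential ground state"` (0 each); `lit search --hybrid "completely
monotone Gaussian
Lennard-Jones type lattice theta hcp fcc"` (BeterminSamajTravenec2022 pp. 6, 8–9 READ: θ/ζ ordering
of fcc/hcp, single
fcc/hcp boundary Fig. 5); `lean search` for completely-monotone / Bernstein machinery in the tree
(only barrier prose and
route PoissonBesselStacking's Bessel engine); arXiv / OpenAlex / S2 were rate-limited (HTTP 429) in
this session, so the
card's two refuter audits (R7 and refuter-12, 2026-08-15, zbMATH + Crossref sweeps) are relied on
for those sources.
Nearest prior art found: Bétermin 2016 arXiv:1502.03839 §4 and BeterminPetrache2019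
(arXiv:1806.02233) — lattice-energy
theorems organised by the sign structure of the inverse-Laplace measure, Lennard-Jones type =
difference of completely
monotone functions; BeterminPetrache2017 Thm 1.1 (θ_fcc < θ_hcp, layer positivity);
BeterminSamajTravenec2022 §3.1 (one
fcc/hcp transition, numerically, among lattices + hcp).
Delta: the  [refs: 10.1063/5.0269606, 1901.08957, 1502.03839, 1806.02233, doi:10.1063/5.0269606, BeterminPetrache2019, BeterminSamajTravenec2022, BeterminPetrache2017]

Barriers (technique_class: total-positivity, bernstein-measure, potential-classes): - technique_class: total-positivity, bernstein-measure, potential-classes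
- Literature.Barriers.AtomisticToContinuum.NoUniversallyOptimalLattice3D: class 0 (completely
monotone) has no 3-D optimum; the route lives in class 1, where ONE balance point t₀ selects density
and stacking, and makes no universal-optimality claim.
- Literature.Barriers.AtomisticToContinuum.Li2022_cohnElkies3D: no two-point LP /
Fourier-interpolation certificate is claimed or prescribed; the class statements are targets whose
proofs are open.
- Literature.Barriers.AtomisticToContinuum.SutoDegenerateGroundStates: Sütő's continuously
degenerate ground states need bounded V with compactly supported V̂ — not representable as a
one-sign-change mixture with divergent core; the class excludes them by hypothesis, which is exactly
why the generic strengthening is restricted to class 1.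
- Literature.Barriers.AtomisticToContinuum.AperiodicTilingGroundStates: the generic "ground states
are periodic" fails for tilings / lattice gases; it does not evade by theorem — the bet is that one
species + radial + one crossing leaves no matching-rule-type forcing, and a single class-1 aperiodic
example closes the route (kill criterion).
- Literature.Barriers.AtomisticToContinuum.Hubbard1978_mostHomogeneous: bites
ClassOneStackingPeriodic: infinite-range convex repulsion at fixed filling has Sturmian ground
states; partial evasion — the stacking model has no conserved filling and its couplings are
one-crossing with an exponent

Novelty grade: new-combination — RREVIEW 2026-08-15 (full text: evidence REVIEW_R3.md on 4041; Assembly proof on 4048). ELAB: 7/7 decls + Assembly rc0; Assembly + glue X_E -> X_P -> X kernel-proved. DEFS: barlowCoupling = Phi_A - Phi_N matches; haggStackingEnergy = liminf H_n/n; no tsum junk (tail r^{-3-eps}); class-1 hyp = Literat (refuter refuter-rreview-route-Schanuel-Arithmeti-73a061ab-0, 2026-08-15T13:49:29Z; prior: BeterminPetrache2019 arXiv:1806.02233 (§1, Thm 1.5); Betermin 2016 arXiv:1502.03839 §4; BeterminPetrache2017; BeterminSamajTravenec2022 §3.1; RegevStephensDavidowitz arXiv:1502.04796; BlancLewin2015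 §2.1; route-AtomisticToContinuum-RefuteCrystalPeriodicMin (closed, superseded))

History (route lifecycle, newest last):
- 2026-08-15T13:45:08Z · CLOSED retired — not-a-thesis: assembly does not conclude the sub-problem Statement (operator:999:1257524)

sub-problem: Crystallization · status: closed(retired) · opened planner-plancard-AtomisticToContinuum-Crystal-27adde06-0 2026-08-15T11:27:10Z · rev 0 · ledger route-AtomisticToContinuum-OneSignChangeClass
GENERATED by the gate from the ledger (D-0016/17). Provers cite these decls: `theorem foo : Summit.AtomisticToContinuum.Crystallization.Theses.OneSignChangeClass.<Decl> := …` in Summits/AtomisticToContinuum/Crystallization/Theorems/<Name>.lean.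
-/

namespace Summit.AtomisticToContinuum.Crystallization.Theses.OneSignChangeClass

open scoped BigOperators Topology Manifold Classical MeasureTheory ProbabilityTheory Matrix InnerProductSpace ComplexConjugate ContinuousMap
open Filter Set Function TopologicalSpace MeasureTheory

attribute [summit_statement] _root_.Crystallization

/-- item stmt-AtomisticToContinuum-4041 · target · rank 0 · closed · moot by None · by planner
why it might fail: it asserts 3-D crystallization for a whole class containing arbitrarily soft members (cores ~ r^{-3.1}, tails ~ −r^{-3.05}); one class-1 potential with a quasicrystalline or infinitely degenerate aperiodic ground state — none is known, none is excluded — refutes it.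
sources: arXiv:1502.03839, BeterminPetrache2019, BlancLewin2015, doi:10.1103/PhysRevLett.79.1261
[target] X: every class-1 pair potential (one-sign-change Gaussian mixture with divergent core, a
negative value, summable tail r^{-3-ε} and stability) has a periodic minimiser of the energy per
particle to which E(N)/N converges, and its ground states converge locally, up to translations and
subsequences, to a non-zero periodic point measure (card L3a; Lennard-Jones, Mie (n,m) with n > m >
3 are members; Morse and Buckingham are not: no divergent core, resp. two sign changes). -/
@[route_item "route-AtomisticToContinuum-OneSignChangeClass"]
def ClassOneCrystallizes : Prop :=
  ∀ V : ℝ → ℝ, ((∃ (w : ℝ → ℝ) (t₀ : ℝ), 0 < t₀ ∧ (∀ t ∈ Set.Ioo 0 t₀, w t ≤ 0) ∧ (∀ t, t₀ ≤ t → 0 ≤ w t) ∧ ∀ r : ℝ, 0 < r → MeasureTheory.IntegrableOn (fun t => Real.exp (-(t * r ^ 2)) * w t) (Set.Ioi 0) ∧ V r = ∫ t in Set.Ioi 0, Real.exp (-(t * r ^ 2)) * w t) ∧ Filter.Tendsto V (nhdsWithin 0 (Set.Ioi 0)) Filter.atTop ∧ (∃ r : ℝ, 0 < r ∧ V r < 0)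 ∧ (∃ C ε : ℝ, 0 < ε ∧ ∀ r : ℝ, 1 ≤ r → |V r| ≤ C * r ^ (-(3 + ε))) ∧ (∃ B : ℝ, ∀ (N : ℕ) (x : Fin N → EuclideanSpace ℝ (Fin 3)), Function.Injective x → -(B * (N : ℝ)) ≤ Literature.MathematicalPhysics.StatisticalMechanics.interactionEnergy V x)) → Literature.MathematicalPhysics.StatisticalMechanics.HasPeriodicGroundStateEnergy V 3 ∧ Literature.MathematicalPhysics.StatisticalMechanics.IsCrystallizing V 3

/-- item stmt-AtomisticToContinuum-4042 · crux · rank 2 · closed · moot by None · by planner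
why it might fail: 3-D positional rigidity for PAIR potentials is unknown even for Lennard-Jones (Flatley–Theil need a three-body term); inside the class, at the fcc/hcp balance point or for soft tails, degenerate stackings are exact minimisers and ground states need not settle on one periodic pattern.
sources: BlancLewin2015, FlatleyTheil2015, Theil2006, BeterminPetrache2019
[crux] X_P: for every class-1 potential V, the energetic form HasPeriodicGroundStateEnergy V 3
implies the Blanc–Lewin positional form IsCrystallizing V 3 (card L3a, positional half; the step
where "one length scale ⇒ no aperiodic order" must become a rigidity theorem). [deps:
ClassOneEnergy] [difficulty: open-problem] -/
@[route_item "route-AtomisticToContinuum-OneSignChangeClass"]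
def ClassOnePositional : Prop :=
  ∀ V : ℝ → ℝ, ((∃ (w : ℝ → ℝ) (t₀ : ℝ), 0 < t₀ ∧ (∀ t ∈ Set.Ioo 0 t₀, w t ≤ 0) ∧ (∀ t, t₀ ≤ t → 0 ≤ w t) ∧ ∀ r : ℝ, 0 < r → MeasureTheory.IntegrableOn (fun t => Real.exp (-(t * r ^ 2)) * w t) (Set.Ioi 0) ∧ V r = ∫ t in Set.Ioi 0, Real.exp (-(t * r ^ 2)) * w t) ∧ Filter.Tendsto V (nhdsWithin 0 (Set.Ioi 0)) Filter.atTop ∧ (∃ r : ℝ, 0 < r ∧ V r < 0) ∧ (∃ C ε : ℝ, 0 < ε ∧ ∀ r : ℝ, 1 ≤ r → |V r| ≤ C * r ^ (-(3 + ε))) ∧ (∃ B : ℝ, ∀ (N : ℕ) (x : Fin N → EuclideanSpace ℝ (Fin 3)), Function.Injective x → -(B * (N : ℝ)) ≤ Literature.MathematicalPhysics.StatisticalMechanics.interactionEnergy V x)) → Literature.MathematicalPhysics.StatisticalMechanics.HasPeriodicGroundStateEnergy V 3 → Literature.MathematicalPhysics.StatisticalMechanics.IsCrystallizing V 3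

/-- item stmt-AtomisticToContinuum-4043 · crux · rank 3 · closed · moot by None · by planner
why it might fail: attainment can fail inside class 1: for soft members the registry couplings are + for k < k₀ (k₀ ≥ 4) then −, a frustrated ANNNI-type chain whose optimal period may diverge at multiphase points (FisherSzpilka1987, Hubbard1978); non-Barlow competitors for soft cores are untested.
sources: BlancLewin2015, BeterminSamajTravenec2022, BeterminPetrache2019, FisherSzpilka1987, Hubbard1978
[crux] X_E: for every class-1 potential V, the minimum of the energy per particle over periodic
configurations of ℝ³ is attained and E(N)/N converges to it (card L3a, energetic half; for
Lennard-Jones this is the conjunct's first half with hcp-type expected, for soft members bcc or fcc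
— the class does not promise close packing). [difficulty: open-problem] -/
@[route_item "route-AtomisticToContinuum-OneSignChangeClass"]
def ClassOneEnergy : Prop :=
  ∀ V : ℝ → ℝ, ((∃ (w : ℝ → ℝ) (t₀ : ℝ), 0 < t₀ ∧ (∀ t ∈ Set.Ioo 0 t₀, w t ≤ 0) ∧ (∀ t, t₀ ≤ t → 0 ≤ w t) ∧ ∀ r : ℝ, 0 < r → MeasureTheory.IntegrableOn (fun t => Real.exp (-(t * r ^ 2)) * w t) (Set.Ioi 0) ∧ V r = ∫ t in Set.Ioi 0, Real.exp (-(t * r ^ 2)) * w t) ∧ Filter.Tendsto V (nhdsWithin 0 (Set.Ioi 0)) Filter.atTop ∧ (∃ r : ℝ, 0 < r ∧ V r < 0) ∧ (∃ C ε : ℝ, 0 < ε ∧ ∀ r : ℝ, 1 ≤ r → |V r| ≤ C * r ^ (-(3 + ε))) ∧ (∃ B : ℝ, ∀ (N : ℕ) (x : Fin N → EuclideanSpace ℝ (Fin 3)), Function.Injective x → -(B * (N : ℝ)) ≤ Literature.MathematicalPhysics.StatisticalMechanics.interactionEnergy V x)) → Literature.MathematicalPhysics.StatisticalMechanics.HasPeriodicGroundStateEnergy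 V 3

/-- item stmt-AtomisticToContinuum-4044 · crux · rank 4 · closed · moot by None · by planner
why it might fail: frustration: if J₂, J₃ > 0 > J₄,… no 3-letter stacking avoids every penalty (pigeonhole on 4 layers) and competing infinite-range tails may push the optimal period to infinity at multiphase points (FisherSzpilka1987, Hubbard1978 barrier); "every a" includes unphysical densities.
sources: FisherSzpilka1987, RadinSchulman1983, Hubbard1978, BeterminPetrache2017, PartayOrtnerCsanyi2017, arXiv:1502.04796
[crux] for every class-1 potential V and every ideal Barlow geometry (in-layer spacing a > 0, layer
spacing h with h² = 2a²/3), the one-dimensional stacking model with couplings J_k = barlowCoupling V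
a h k (aligned minus non-aligned layer interaction) has a PERIODIC Hägg sequence minimising the
stacking energy density haggStackingEnergy among all Hägg sequences — the class-wide form of
stacking selection, where the one-crossing sign pattern of J (ClassOneRegistryOneCrossing) is the
only structural input; foreseen child of ClassOneEnergy. [deps: ClassOneRegistryOneCrossing]
[difficulty: L] -/
@[route_item "route-AtomisticToContinuum-OneSignChangeClass"]
def ClassOneStackingPeriodic : Prop :=
  ∀ V : ℝ → ℝ, ((∃ (w : ℝ → ℝ) (t₀ : ℝ), 0 < t₀ ∧ (∀ t ∈ Set.Ioo 0 t₀, w t ≤ 0) ∧ (∀ t, t₀ ≤ t → 0 ≤ w t) ∧ ∀ r : ℝ, 0 < r → MeasureTheory.IntegrableOn (fun t => Real.exp (-(t * r ^ 2)) * w t) (Set.Ioi 0) ∧ V r = ∫ t in Set.Ioi 0, Real.exp (-(t * r ^ 2)) * w t) ∧ Filter.Tendsto V (nhdsWithin 0 (Set.Ioi 0)) Filter.atTop ∧ (∃ r : ℝ, 0 < r ∧ V r < 0) ∧ (∃ C ε : ℝ, 0 < ε ∧ ∀ r : ℝ, 1 ≤ r → |V r| ≤ C * r ^ (-(3 + ε)))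 ∧ (∃ B : ℝ, ∀ (N : ℕ) (x : Fin N → EuclideanSpace ℝ (Fin 3)), Function.Injective x → -(B * (N : ℝ)) ≤ Literature.MathematicalPhysics.StatisticalMechanics.interactionEnergy V x)) → ∀ a h : ℝ, 0 < a → 0 < h → h ^ 2 = 2 / 3 * a ^ 2 → ∃ (s : ℤ → ℤ) (p : ℕ), Literature.MathematicalPhysics.StatisticalMechanics.IsHaggSeq s ∧ 0 < p ∧ (∀ i : ℤ, s (i + p) = s i) ∧ ∀ s' : ℤ → ℤ, Literature.MathematicalPhysics.StatisticalMechanics.IsHaggSeq s' → Literature.MathematicalPhysics.StatisticalMechanics.haggStackingEnergy (Literature.MathematicalPhysics.StatisticalMechanics.barlowCoupling V a h) s ≤ Literature.MathematicalPhysics.StatisticalMechanics.haggStackingEnergy (Literature.MathematicalPhysics.StatisticalMechanics.barlowCoupling V a h) s'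

/-- item stmt-AtomisticToContinuum-4045 · support · rank 9 · closed · moot by None · by planner
sources: BlancLewin2015, Schoenberg1938, PolyaSzego1925
[support] Lennard-Jones is class 1: lennardJones r = ∫_0^∞ e^{-t r²}(t⁵/1440 − t²/12) dt for r > 0
(Γ(6) = 120, Γ(3) = 2; Mathlib Real.integral_rpow_mul_exp_neg_mul_Ioi), one sign change at t₀ =
120^{1/3}; divergent core, V(1) = −1/12 < 0, |V(r)| ≤ r⁻⁶/4 for r ≥ 1 (ε = 3), stability from the
proved fact lennardJones_stable_holds (StablePotentialsProofs). [difficulty: provable-now] -/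
@[route_item "route-AtomisticToContinuum-OneSignChangeClass"]
def LennardJonesClassOne : Prop :=
  (∃ (w : ℝ → ℝ) (t₀ : ℝ), 0 < t₀ ∧ (∀ t ∈ Set.Ioo 0 t₀, w t ≤ 0) ∧ (∀ t, t₀ ≤ t → 0 ≤ w t) ∧ ∀ r : ℝ, 0 < r → MeasureTheory.IntegrableOn (fun t => Real.exp (-(t * r ^ 2)) * w t) (Set.Ioi 0) ∧ Literature.MathematicalPhysics.StatisticalMechanics.lennardJones r = ∫ t in Set.Ioi 0, Real.exp (-(t * r ^ 2)) * w t) ∧ Filter.Tendsto Literature.MathematicalPhysics.StatisticalMechanics.lennardJones (nhdsWithin 0 (Set.Ioi 0)) Filter.atTop ∧ (∃ r : ℝ, 0 < r ∧ Literature.MathematicalPhysics.StatisticalMechanics.lennardJones r < 0) ∧ (∃ C ε : ℝ, 0 < ε ∧ ∀ r : ℝ, 1 ≤ r → |Literature.MathematicalPhysics.StatisticalMechanics.lennardJones r| ≤ C * r ^ (-(3 + ε))) ∧ (∃ B : ℝ, ∀ (N : ℕ) (x : Fin N → EuclideanSpace ℝ (Fin 3)), Function.Injective x → -(B * (N : ℝ))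 ≤ Literature.MathematicalPhysics.StatisticalMechanics.interactionEnergy Literature.MathematicalPhysics.StatisticalMechanics.lennardJones x)

/-- item stmt-AtomisticToContinuum-4046 · support · rank 9 · closed · moot by None · by planner
sources: arXiv:1502.04796, BeterminPetrache2017, Karlin1968, PolyaSzego1925
[support] one crossing survives the layer sums (card L1/L2 engine): for a one-sign-change Gaussian
mixture V with summable tail and any triangular-layer geometry a, h > 0, the registry couplings k ↦
J_k = barlowCoupling V a h k (k ≥ 1) change sign at most once and only from + to −: J_{k₁} ≤ 0 ⇒
J_{k₂} ≤ 0 for k₂ ≥ k₁. Proof sketch: J_k = D(kh), D(z) = ∫ e^{-t z²} F(t) w(t) dt with F(t) =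
Θ_Λ(t) − Θ_{Λ+w}(t) ≥ 0 (shifted-Gaussian-mass inequality, Regev–Stephens-Davidowitz
arXiv:1502.04796 Thm 1.1 / BeterminPetrache2017), and s ↦ e^{t₀ s} D(√s) is non-increasing.
[difficulty: M] -/
@[route_item "route-AtomisticToContinuum-OneSignChangeClass"]
def ClassOneRegistryOneCrossing : Prop :=
  ∀ V : ℝ → ℝ, ((∃ (w : ℝ → ℝ) (t₀ : ℝ), 0 < t₀ ∧ (∀ t ∈ Set.Ioo 0 t₀, w t ≤ 0) ∧ (∀ t, t₀ ≤ t → 0 ≤ w t) ∧ ∀ r : ℝ, 0 < r → MeasureTheory.IntegrableOn (fun t => Real.exp (-(t * r ^ 2)) * w t) (Set.Ioi 0) ∧ V r = ∫ t in Set.Ioi 0, Real.exp (-(t * r ^ 2)) * w t) ∧ (∃ C ε : ℝ, 0 < ε ∧ ∀ r : ℝ, 1 ≤ r → |V r| ≤ C * r ^ (-(3 + ε)))) → ∀ a h : ℝ, 0 < a → 0 < h → ∀ k₁ k₂ : ℕ, 1 ≤ k₁ → k₁ ≤ k₂ → Literature.MathematicalPhysics.StatisticalMechanics.barlowCoupling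 V a h k₁ ≤ 0 → Literature.MathematicalPhysics.StatisticalMechanics.barlowCoupling V a h k₂ ≤ 0

/-- item stmt-AtomisticToContinuum-4047 · support · rank 9 · closed · moot by None · by planner
sources: Karlin1968, PolyaSzego1925, Schoenberg1938
[support] one crossing in real space (card L1, real half): a one-sign-change Gaussian mixture with
divergent core and a negative value has exactly one well — there is r₀ > 0 with V strictly
decreasing on (0, r₀] and strictly increasing on [r₀, ∞) (no shoulder, no bump, no second minimum:
the Dzugutov / Lennard-Jones–Gauss mechanisms for one-component quasicrystals are unavailable in
class 1). Proof sketch: V′(r) = −2r g(r²), g(s) = ∫ t e^{-ts} w(t) dt, and e^{t₀ s} g(s) is strictly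
decreasing. [difficulty: M] -/
@[route_item "route-AtomisticToContinuum-OneSignChangeClass"]
def ClassOneSingleWell : Prop :=
  ∀ V : ℝ → ℝ, ((∃ (w : ℝ → ℝ) (t₀ : ℝ), 0 < t₀ ∧ (∀ t ∈ Set.Ioo 0 t₀, w t ≤ 0) ∧ (∀ t, t₀ ≤ t → 0 ≤ w t) ∧ ∀ r : ℝ, 0 < r → MeasureTheory.IntegrableOn (fun t => Real.exp (-(t * r ^ 2)) * w t) (Set.Ioi 0) ∧ V r = ∫ t in Set.Ioi 0, Real.exp (-(t * r ^ 2)) * w t) ∧ Filter.Tendsto V (nhdsWithin 0 (Set.Ioi 0)) Filter.atTop ∧ (∃ r : ℝ, 0 < r ∧ V r < 0)) → ∃ r₀ : ℝ, 0 < r₀ ∧ StrictAntiOn V (Set.Ioc 0 r₀) ∧ StrictMonoOn V (Set.Ici r₀)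

/-- item stmt-AtomisticToContinuum-4048 · assembly · rank 1 · closed · moot by None · by planner
sources: BlancLewin2015
[assembly] ClassOneEnergy → ClassOnePositional → LennardJonesClassOne → Crystallization. -/
@[route_item "route-AtomisticToContinuum-OneSignChangeClass"]
def Assembly : Prop :=
  ClassOneEnergy → ClassOnePositional → LennardJonesClassOne → Literature.MathematicalPhysics.StatisticalMechanics.Crystallization

end Summit.AtomisticToContinuum.Crystallization.Theses.OneSignChangeClass
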